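import Mathlib

/-!
# Phase-torus law — «control» lens g5, LINE for idea-crit-6 (2026-08-29)

Crux of record: `Summit.HodgeConjecture.HodgeConjecture.Theses.EightfoldBlochSeeds.BlochSeedDiscOne`
(= `HasHyperbolicBlochSeed 4 1`, item stmt-HodgeConjecture-18881; skeleton `Lines/birth.lean`, STUB R
`stub_rung_pad4_seedAt`, named technique = PAD-4 two-level ⊕-block design with a TWO-TERM line-bundle
presentation `0 → 𝓔 → ⊕ L_i → ⊕ M_j → 0` / `⊕ M_j → ⊕ L_i → 𝓔 → 0`).
Nothing in this file proves HC, HC_AV, HC_CM, H2 or item 18881.  v3 = v2.2 + PARTS C and A·B·D TYPED (spec signatures by control g5,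
bodies by s4-prove-1 g32, 2026-08-29): the file is `sorry`-free; `stub_coveringLemma` is closed by `coveringLemma_holds` and the
law itself by `phaseTorusLaw_holds : PhaseTorusLaw` (kernel, axioms standard) — a finite harmonic-analysis theorem on `(μ₄)⁴`;
the tower-side dictionary (M)(T) is typed separately (`LinePhaseTorus.lean`).
v4 = v3 + PART E (control g5): `box_cover_seven` (greedy halving) and `phaseTorusLaw7_holds : PhaseTorusLaw7` — the same law
at corank `≤ 7`, the sharp covering range of memo §9 (the first covering obstruction is `|A| = 8`).

## The law (pen ×2: this seat + idea-crit-6 g10 bus l.35820, director WORD «PHASE-TORUS ×2 (pen)» R19.132 l.35827; numerics `ctl/moments.py` 4f5d37053c3e568a, `ctl/phasetorus_check.py` ac20110cde10246e; v2 = `stub_coveringLemma` closed in the kernel by s4-prove-1 g32, bus l.35841)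

Let `n ≥ 2` (the LINE height, 14 or 16 in the census) and let `ν = m_N − m_P` be an INTEGER two-level letter
design all of whose letters `(a_f, β_f)`, `β_f = c_f·u_f`, `u_f ∈ μ₄`, lie on the line `a_f + c_f = n`.
Write `V(x) = c₀c₁c₂c₃`, `U(x) = u₀u₁u₂u₃` (FC cells), `μ(ν) = Σ_x ν(x) β₀β₁β₂β₃`.

* (M)  (H1)-clean on the line ⟺ `e^{-nH}·ch(ν) = Σ_x ν(x) Π_f (1 − c_f I_f + β_f e_f + β̄_f ē_f)
        = γ + ρ·nH + μ·e₀e₁e₂e₃ + μ̄·ē₀ē₁ē₂ē₃`; equivalently every mixed moment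
        `Σ_x ν(x) Π_{f∈S} g_f(x)` with `|S| ≥ 2`, `g_f ∈ {c_f, β_f, β̄_f}` VANISHES except `Π β_f = μ`, `Π β̄_f = μ̄`
        (checked digit-for-digit on six bc5 designs at n = 14, 16, incl. 1db9cf28ed5a048e and f24af79f04ae532c).
* (T)  a P-saturating UP-Hall flow `π` (live pair ⟺ per factor the N-letter is the P-letter slid toward the apex
        along its own ray) with integer residual `r = m_N − inflow ≥ 0`, `Σ r = γ = rank`, gives
        `Σ_x ν(x)V(x)χ(u(x)) = Σ_y W(y)χ(u(y))` for every character `χ` of `(μ₄)⁴`, where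
        `W(y) = r(y)V(y) − Σ_{x'} π(y,x')(V(y) − V(x')) ≤ 0` unless `r(y) > 0` (≤ γ cells).
* (P)  PHASE-TORUS LAW below with `A = u({y : r(y) > 0})`, `|A| ≤ γ ≤ 4`, `ω = u_* W` ⟹ `μ = 0`.
* DOWN (kernel) orientation: `W ≥ 0` and `Σ W = Σ ν V = 0` ⟹ `W = 0` ⟹ `μ = 0` for EVERY rank.

CONSEQUENCE (h-uniform C3): no two-term line-bundle presentation (either orientation, any maps — rank ≤ term
rank, König–Egerváry — any support, any LINE height n) of a bundle of rank ≤ 4 has Weil charge μ ≠ 0.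
-/

namespace Summit.HodgeConjecture.HodgeConjecture.Cruxes.BlochSeedDiscOne.PhaseTorus

open Finset BigOperators

/-- The phase torus `(μ₄)⁴`, written additively: `t_f = i^{τ_f}`. -/
abbrev PT : Type := Fin 4 → ZMod 4

/-- The character `χ_k(τ) = i^{Σ_f k_f τ_f}`. -/
noncomputable def chi (k τ : PT) : ℂ := Complex.I ^ (∑ f, k f * τ f).val

/-- Admissible («clean») frequencies `K″`: every entry in `{0, ±1}` and `k ≠ ±(1,1,1,1)`.
These are exactly the (H1) rows seen by the top word after the transport identity (T). -/
def KAdm (k : PT) : Prop := (∀ f, k f ≠ 2) ∧ k ≠ (fun _ => 1) ∧ k ≠ (fun _ => 3)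

/-- The `k`-th moment of a real signed measure `ω` on the phase torus. -/
noncomputable def moment (ω : PT → ℝ) (k : PT) : ℂ := ∑ τ, (ω τ : ℂ) * chi k τ

/-- **Phase-torus law** (first lemma of the LINE; finite harmonic analysis on `(μ₄)⁴`):
a real signed measure whose clean moments vanish and which is non-positive outside at most four points
has vanishing top holomorphic moment.  In the dictionary of the module docstring `moment ω (1,1,1,1) = μ`. -/
def PhaseTorusLaw : Prop :=
  ∀ (ω : PT → ℝ) (A : Finset PT), A.card ≤ 4 → (∀ τ, τ ∉ A → ω τ ≤ 0) →
    (∀ k, KAdm k → moment ω k = 0) → moment ω (fun _ => 1) = 0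

/-- Two phases `i^x, i^y` are NOT opposite. A set of pairwise non-opposite values of `μ₄` has ≤ 2 elements
and is a point or an adjacent pair `{s, i·s}` = the zero set of a non-negative `φ ∈ span_ℝ{1, t, t̄}`
(`1 − Re(s̄t)`, resp. `1 + Re((−1+i)s̄t)`). -/
def NonOpp (x y : ZMod 4) : Prop := y ≠ x + 2

/-- **Covering lemma** («opposite» is a perfect matching of `μ₄`, so among any three values two are
non-opposite — `nonOpp_of_three`; erratum of memo v1 §2 (C) fixed per idea-crit-6 ×2, bus l.35820; exhaustive
numeric check on 91 390 four-sets, `phasetorus_check.py`; SHARP RANGE: the box form holds for every `|A| ≤ 7`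
by double counting — memo v1.1 §9 — and fails first at the even-weight real 8-set `E8`):
at most four points of `(μ₄)⁴` can be assigned to three of the four coordinates so that points sharing a
coordinate carry non-opposite values there; the fourth coordinate stays FREE (it carries the adjustable phase
of the test function `F = Π_f φ_f(t_f) ≥ 0`, `F|_A = 0`, `supp F̂ ⊆ {0,±1}⁴`, whose pairing with `ω` is
`2·Re(a·μ)` with `a ≠ 0` of arbitrary argument — whence `μ = 0`). -/
def CoveringLemma : Prop :=
  ∀ A : Finset PT, A.card ≤ 4 →
    ∃ f₀ : Fin 4, ∃ g : PT → Fin 4, (∀ a ∈ A, g a ≠ f₀) ∧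
      ∀ a ∈ A, ∀ b ∈ A, g a = g b → NonOpp (a (g a)) (b (g a))

/-- `NonOpp` is reflexive: `x ≠ x + 2` in `ZMod 4`. -/
theorem nonOpp_refl (x : ZMod 4) : NonOpp x x := by
  unfold NonOpp; revert x; decide

/-- `NonOpp` is symmetric (`−2 = 2` in `ZMod 4`). -/
theorem nonOpp_symm {x y : ZMod 4} (h : NonOpp x y) : NonOpp y x := by
  unfold NonOpp at h ⊢; revert x y; decide

/-- «Opposite» is a perfect matching of `μ₄`, so among any three values two are non-opposite
(equal or adjacent): the pigeonhole step of the pen proof. -/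
theorem nonOpp_of_three (x y z : ZMod 4) : NonOpp x y ∨ NonOpp x z ∨ NonOpp y z := by
  unfold NonOpp; revert x y z; decide

/-- If `g` is injective on `A`, the same-coordinate condition holds trivially (only `a = b` occurs). -/
theorem cover_of_injOn {A : Finset PT} {g : PT → Fin 4} (hg : Set.InjOn g A) :
    ∀ a ∈ A, ∀ b ∈ A, g a = g b → NonOpp (a (g a)) (b (g a)) := by
  intro a ha b hb h
  obtain rfl := hg ha hb h
  exact nonOpp_refl _

/-- **The covering lemma holds** (pen proof `PHASE-TORUS-LAW-g5.md` §2 (C), kernel-checked): for `|A| ≤ 3` host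
the points on three distinct coordinates; for `|A| = 4` host the non-opposite pair among the first three points'
values at coordinate `0` on coordinate `0`, the remaining two points on coordinates `1`, `2`; coordinate `3` free. -/
theorem coveringLemma_holds : CoveringLemma := by
  intro A hA
  have hnd : A.toList.Nodup := A.nodup_toList
  have hlen : A.toList.length ≤ 4 := by rw [Finset.length_toList]; exact hA
  have hmem : ∀ p, p ∈ A ↔ p ∈ A.toList := fun p => Finset.mem_toList.symm
  generalize A.toList = l at hnd hlen hmem
  rcases l with _ | ⟨a, _ | ⟨b, _ | ⟨c, _ | ⟨d, _ | ⟨e, l⟩⟩⟩⟩⟩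
  · -- A = ∅
    refine ⟨0, fun _ => 1, fun p hp => ?_, fun p hp => ?_⟩ <;> simp [hmem] at hp
  · -- A = {a}
    refine ⟨3, fun _ => 0, fun _ _ => show (0 : Fin 4) ≠ 3 by decide, fun p hp q hq _ => ?_⟩
    simp only [hmem, List.mem_cons, List.not_mem_nil, or_false] at hp hq
    subst hp; subst hq; exact nonOpp_refl _
  · -- A = {a, b}
    simp only [List.nodup_cons, List.mem_cons, List.not_mem_nil, or_false] at hnd
    obtain ⟨hab, -⟩ := hnd
    refine ⟨3, fun p => if p = a then 0 else 1, fun p _ => by dsimp only; split_ifs <;> decide, ?_⟩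
    refine cover_of_injOn fun p hp q hq h => ?_
    simp only [Finset.mem_coe, hmem, List.mem_cons, List.not_mem_nil, or_false] at hp hq
    rcases hp with rfl | rfl <;> rcases hq with rfl | rfl <;> simp_all [eq_comm]
  · -- A = {a, b, c}
    simp only [List.nodup_cons, List.mem_cons, List.not_mem_nil, or_false, not_or] at hnd
    obtain ⟨⟨hab, hac⟩, hbc, -⟩ := hnd
    refine ⟨3, fun p => if p = a then 0 else if p = b then 1 else 2,
      fun p _ => by dsimp only; split_ifs <;> decide, ?_⟩
    refine cover_of_injOn fun p hp q hq h => ?_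
    simp only [Finset.mem_coe, hmem, List.mem_cons, List.not_mem_nil, or_false] at hp hq
    rcases hp with rfl | rfl | rfl <;> rcases hq with rfl | rfl | rfl <;> simp_all [eq_comm]
  · -- A = {a, b, c, d}
    simp only [List.nodup_cons, List.mem_cons, List.not_mem_nil, or_false, not_or] at hnd
    obtain ⟨⟨hab, hac, had⟩, ⟨hbc, hbd⟩, hcd, -⟩ := hnd
    have hba := Ne.symm hab; have hca := Ne.symm hac; have hda := Ne.symm had
    have hcb := Ne.symm hbc; have hdb := Ne.symm hbd; have hdc := Ne.symm hcd
    have hmem' : ∀ p, p ∈ A ↔ p = a ∨ p = b ∨ p = c ∨ p = d := fun p => by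
      rw [hmem]; simp only [List.mem_cons, List.not_mem_nil, or_false]
    -- the pigeonhole pair among the values at coordinate 0 of a, b, c
    rcases nonOpp_of_three (a 0) (b 0) (c 0) with h | h | h
    · -- host a, b on 0; c on 1; d on 2
      refine ⟨3, fun p => if p = c then 1 else if p = d then 2 else 0,
        fun p _ => by dsimp only; split_ifs <;> decide, fun p hp q hq => ?_⟩
      rw [hmem'] at hp hq
      rcases hp with rfl | rfl | rfl | rfl <;> rcases hq with rfl | rfl | rfl | rfl <;>
        simp [hac, had, hbc, hbd, hdc, nonOpp_refl, h, nonOpp_symm h]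
    · -- host a, c on 0; b on 1; d on 2
      refine ⟨3, fun p => if p = b then 1 else if p = d then 2 else 0,
        fun p _ => by dsimp only; split_ifs <;> decide, fun p hp q hq => ?_⟩
      rw [hmem'] at hp hq
      rcases hp with rfl | rfl | rfl | rfl <;> rcases hq with rfl | rfl | rfl | rfl <;>
        simp [hab, had, hcd, hcb, hdb, nonOpp_refl, h, nonOpp_symm h]
    · -- host b, c on 0; a on 1; d on 2
      refine ⟨3, fun p => if p = a then 1 else if p = d then 2 else 0,
        fun p _ => by dsimp only; split_ifs <;> decide, fun p hp q hq => ?_⟩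
      rw [hmem'] at hp hq
      rcases hp with rfl | rfl | rfl | rfl <;> rcases hq with rfl | rfl | rfl | rfl <;>
        simp [hbd, hcd, hba, hca, hda, nonOpp_refl, h, nonOpp_symm h]
  · -- |l| ≥ 5 contradicts |A| ≤ 4
    simp only [List.length_cons] at hlen
    omega

/-- Former STUB, now CLOSED in the kernel by `coveringLemma_holds` (pen proof `PHASE-TORUS-LAW-g5.md` §2 (C);
typed by s4-prove-1 g32, 2026-08-29). Name kept so that downstream references are unchanged. -/
theorem stub_coveringLemma : CoveringLemma := coveringLemma_holds

/-! ### Typing target (director-hodge R19.132): `PhaseTorusLaw` — CLOSED below (PART C character calculus, PARTS A·B·D box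
covering, value-table bumps, product certificate ⇒ `phaseTorusLaw_holds`; the single-file plan replaced the sibling workfiles). -/

/-- The kernel-orientation half is pure bookkeeping: a non-negative weight with zero total is zero.
(`W ≥ 0`, `Σ W = Σ ν V = 0` by the `IIII` row of (M).) -/
theorem down_orientation_dead {ι : Type*} (s : Finset ι) (W : ι → ℝ) (hW : ∀ y ∈ s, 0 ≤ W y)
    (hsum : ∑ y ∈ s, W y = 0) : ∀ y ∈ s, W y = 0 :=
  (Finset.sum_eq_zero_iff_of_nonneg hW).1 hsum

/-! ## PART C — character calculus on `(ℤ/4)⁴` (SPEC by control g5; signatures FIXED; bodies = hands, keyed hodge-lit-semireg-typer-2 g11 / any idle hand — say which on the bus) -/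

/-! #### PART C helpers (s4-prove-1 g32): `e s = i^s` on `ℤ/4`, its additivity, conjugation, values -/

/-- `e s = i ^ s` for `s ∈ ℤ/4` (well defined since `i⁴ = 1`); `chi k τ = e (∑ f, k f * τ f)` by `rfl`. -/
noncomputable def e (s : ZMod 4) : ℂ := Complex.I ^ s.val

theorem e_zero : e 0 = 1 := by simp [e]

theorem I_pow_four_mul_add (q r : ℕ) : Complex.I ^ (4 * q + r) = Complex.I ^ r := by
  rw [pow_add, pow_mul, Complex.I_pow_four, one_pow, one_mul]

/-- `e (x + y) = e x * e y`. -/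
theorem e_add (x y : ZMod 4) : e (x + y) = e x * e y := by
  unfold e
  rw [← pow_add]
  have h : (x + y).val = (x.val + y.val) % 4 := ZMod.val_add x y
  rw [h]
  conv_rhs => rw [← Nat.div_add_mod (x.val + y.val) 4]
  rw [I_pow_four_mul_add]

theorem norm_e (x : ZMod 4) : ‖e x‖ = 1 := by
  simp [e, Complex.norm_I]

theorem e_ne_zero (x : ZMod 4) : e x ≠ 0 := fun h => by
  have := norm_e x
  rw [h, norm_zero] at this
  exact zero_ne_one this

/-- `e (-x) = conj (e x)` (`|e x| = 1`). -/
theorem e_neg (x : ZMod 4) : e (-x) = (starRingEnd ℂ) (e x) := by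
  have h1 : e (-x) * e x = 1 := by rw [← e_add, neg_add_cancel, e_zero]
  have h2 : (starRingEnd ℂ) (e x) * e x = 1 := by
    rw [mul_comm, Complex.mul_conj, Complex.normSq_eq_norm_sq, norm_e]; norm_num
  exact mul_right_cancel₀ (e_ne_zero x) (h1.trans h2.symm)

/-- `e (∑ f, s f) = ∏ f, e (s f)` over `Fin 4`. -/
theorem e_sum (s : Fin 4 → ZMod 4) : e (∑ f, s f) = ∏ f, e (s f) := by
  rw [Fin.sum_univ_four, Fin.prod_univ_four, e_add, e_add, e_add]

theorem zmod4_cases (x : ZMod 4) : x = 0 ∨ x = 1 ∨ x = 2 ∨ x = 3 := by revert x; decide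

theorem three_eq_neg_one : (3 : ZMod 4) = -1 := by decide

/-- A sum over `ℤ/4` written out. -/
theorem sum_univ_zmod4 {M : Type*} [AddCommMonoid M] (g : ZMod 4 → M) : ∑ j, g j = g 0 + g 1 + g 2 + g 3 := by
  have h : (Finset.univ : Finset (ZMod 4)) = {0, 1, 2, 3} := by decide
  rw [h, Finset.sum_insert (by decide), Finset.sum_insert (by decide), Finset.sum_insert (by decide),
    Finset.sum_singleton, add_assoc, add_assoc]

theorem e_one : e 1 = Complex.I := by
  rw [e, show (1 : ZMod 4).val = 1 from by decide, pow_one]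

theorem e_two : e 2 = -1 := by
  rw [e, show (2 : ZMod 4).val = 2 from by decide, Complex.I_sq]

theorem e_three : e 3 = -Complex.I := by
  rw [three_eq_neg_one, e_neg, e_one, Complex.conj_I]

/-- The four values of `e`. -/
theorem e_cases (x : ZMod 4) : e x = 1 ∨ e x = Complex.I ∨ e x = -1 ∨ e x = -Complex.I := by
  rcases zmod4_cases x with rfl | rfl | rfl | rfl
  · exact Or.inl e_zero
  · exact Or.inr (Or.inl e_one)
  · exact Or.inr (Or.inr (Or.inl e_two))
  · exact Or.inr (Or.inr (Or.inr e_three))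

theorem e_three_mul (x : ZMod 4) : e (3 * x) = (starRingEnd ℂ) (e x) := by
  rw [three_eq_neg_one, neg_one_mul, e_neg]

/-- `chi k τ = ∏ f, e (k f * τ f)` (the `e`-form of `chi_eq_prod`). -/
theorem chi_eq_prod_e (k τ : PT) : chi k τ = ∏ f, e (k f * τ f) := by
  rw [chi, ← e_sum]; rfl

/-- Value at `x` of the coordinate-`f` trigonometric polynomial with coefficient table `c f`. -/
noncomputable def trig (c : Fin 4 → ZMod 4 → ℂ) (f : Fin 4) (x : ZMod 4) : ℂ := ∑ j, c f j * e (j * x)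

/-- The product function `F(τ) = ∏_f φ_f(τ_f)` of four trigonometric polynomials. -/
noncomputable def prodF (c : Fin 4 → ZMod 4 → ℂ) (τ : PT) : ℂ := ∏ f, trig c f (τ f)

/-- Fourier expansion of the product: `F(τ) = ∑_k (∏_f c_f(k_f)) χ_k(τ)` (`Finset.prod_univ_sum`). -/
theorem prodF_eq_sum (c : Fin 4 → ZMod 4 → ℂ) (τ : PT) :
    prodF c τ = ∑ k : PT, (∏ f, c f (k f)) * chi k τ := by
  unfold prodF trig
  rw [Finset.prod_univ_sum]
  simp only [Fintype.piFinset_univ]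
  refine Finset.sum_congr rfl fun k _ => ?_
  rw [Finset.prod_mul_distrib, chi_eq_prod_e]

/-- Pairing with `ω`: `∑_τ ω(τ) F(τ) = ∑_k (∏_f c_f(k_f)) · moment ω k`. -/
theorem pairing_eq (c : Fin 4 → ZMod 4 → ℂ) (ω : PT → ℝ) :
    ∑ τ, (ω τ : ℂ) * prodF c τ = ∑ k : PT, (∏ f, c f (k f)) * moment ω k := by
  simp only [prodF_eq_sum, moment, Finset.mul_sum]
  rw [Finset.sum_comm]
  refine Finset.sum_congr rfl fun k _ => Finset.sum_congr rfl fun τ _ => ?_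
  ring



/-- `I ^ n` only depends on `n mod 4`. -/
theorem I_pow_mod_four (n : ℕ) : Complex.I ^ (n % 4) = Complex.I ^ n := by
  conv_rhs => rw [← Nat.div_add_mod n 4]
  exact (I_pow_four_mul_add _ _).symm

/-- additivity of the exponent through `ZMod.val` (uses `I ^ 4 = 1`). -/
theorem I_pow_val_add (x y : ZMod 4) :
    Complex.I ^ (x + y).val = Complex.I ^ x.val * Complex.I ^ y.val := by
  exact e_add x y

/-- a character is the product of its one-coordinate factors. -/
theorem chi_eq_prod (k τ : PT) : chi k τ = ∏ f, Complex.I ^ ((k f * τ f).val) := by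
  exact chi_eq_prod_e k τ

/-- `χ_{−k} = conj χ_k`. -/
theorem chi_neg_eq_conj (k τ : PT) : chi (-k) τ = (starRingEnd ℂ) (chi k τ) := by
  change e _ = (starRingEnd ℂ) (e _)
  rw [← e_neg]
  congr 1
  simp only [Pi.neg_apply, neg_mul, Finset.sum_neg_distrib]

/-- real measures have conjugate-symmetric moments: `ω̂(−k) = conj ω̂(k)`. -/
theorem moment_neg_eq_conj (ω : PT → ℝ) (k : PT) :
    moment ω (-k) = (starRingEnd ℂ) (moment ω k) := by
  unfold moment
  rw [map_sum]
  refine Finset.sum_congr rfl fun τ _ => ?_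
  rw [map_mul, Complex.conj_ofReal, chi_neg_eq_conj]

/-- in particular `moment ω (3,3,3,3) = conj (moment ω (1,1,1,1))` (`μ̄`). -/
theorem moment_three_eq_conj_moment_one (ω : PT → ℝ) :
    moment ω (fun _ => 3) = (starRingEnd ℂ) (moment ω (fun _ => 1)) := by
  rw [show (fun _ => (3 : ZMod 4) : PT) = -(fun _ => 1) from funext fun _ => by rw [Pi.neg_apply]; decide]
  exact moment_neg_eq_conj ω _

/-- **Pairing expansion**: pairing `ω` against a product of one-coordinate trigonometric polynomials
`Σ_j b_f(j) I^{j t}` is the corresponding combination of moments (`Finset.prod_univ_sum` + `chi_eq_prod`). -/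
theorem pairing_expansion (ω : PT → ℝ) (b : Fin 4 → ZMod 4 → ℂ) :
    ∑ τ : PT, (ω τ : ℂ) * ∏ f, (∑ j : ZMod 4, b f j * Complex.I ^ ((j * τ f).val)) =
      ∑ k : PT, (∏ f, b f (k f)) * moment ω k := by
  exact pairing_eq b ω


/-! ## PARTS A·B·D — box covering, value-table bumps, product certificate ⇒ `phaseTorusLaw_holds`
(SPEC by control g5; signatures FIXED; bodies = s4-prove-1 g32).
PLAN.  (A) BOX COVERING from `coveringLemma_holds`: the values hosted on one coordinate are pairwise `NonOpp`,
hence lie in an adjacent pair `{s, s+1}` (`exists_pair_cover`, 16 subsets, `decide`).  (B) BUMPS BY VALUE TABLE: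
`bumpPair s` = (0,0,2,2) on (s, s+1, s+2, s+3) = `1 + Re(z_s · conj(i^t))`, `z_s = (−1−i)·i^s`; `bumpFree w` =
(3/2, 1, 1/2, 1) on (w, w+1, w+2, w+3) = `1 + ½ Re(conj(i^w) i^t)`; each is a 3-term character sum with the
coefficient tables `coefPair`, `coefFree` (zero at frequency 2) — pointwise identities, 16 cases each (`fin_cases`; `norm_num`).
(D) ASSEMBLY: `F_w(τ) = Π_f φ_f(τ f)` (φ_{f₀} = bumpFree w, φ_f = bumpPair (s f) otherwise; `Fin.prod_univ_four`);
`F_w ≥ 0`, `F_w|_A = 0`, so `Σ_τ ω τ · F_w τ ≤ 0`; by `pairing_expansion` it equals `Σ_k c_k(w) · moment ω k` with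
`c_k(w) = 0` when some `k f = 2` (`coefPair_two`, `coefFree_two`), `moment ω k = 0` for `KAdm k`, leaving
`c₁(w) μ + c₃(w) μ̄ = 2 Re(c₁(w) μ)` (`moment_three_eq_conj_moment_one`), `c₁(w) = P · i^{−w}/4`, `P = Π_{f ≠ f₀} conj(z_{s f})/2 ≠ 0`
(`zPair_ne_zero`); the four inequalities (w = 0,1,2,3) give `Re(Pμ) = Im(Pμ) = 0`, so `μ = 0`. -/


/-! ## (A) box covering -/

/-- pairwise non-opposite values of `ℤ/4` lie in an adjacent pair. -/
theorem exists_pair_cover (V : Finset (ZMod 4)) (h : ∀ x ∈ V, ∀ y ∈ V, NonOpp x y) :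
    ∃ s : ZMod 4, ∀ x ∈ V, x = s ∨ x = s + 1 := by
  revert h; revert V; unfold NonOpp; decide

/-- Box form of the covering lemma: a free coordinate `f₀` and hosting pairs `{s f, s f + 1}`. -/
def CoveringLemmaBox : Prop :=
  ∀ A : Finset PT, A.card ≤ 4 →
    ∃ f₀ : Fin 4, ∃ s : Fin 4 → ZMod 4, ∀ a ∈ A, ∃ f, f ≠ f₀ ∧ (a f = s f ∨ a f = s f + 1)

theorem coveringLemmaBox_holds : CoveringLemmaBox := by
  intro A hA
  obtain ⟨f₀, g, hgf, hg⟩ := coveringLemma_holds A hA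
  -- on each coordinate the hosted values are pairwise non-opposite, hence inside an adjacent pair
  have hwin : ∀ f, ∃ s : ZMod 4, ∀ a ∈ A, g a = f → a f = s ∨ a f = s + 1 := by
    intro f
    obtain ⟨s, hs⟩ := exists_pair_cover ((A.filter (fun a => g a = f)).image (fun a => a f)) (by
      intro x hx y hy
      simp only [Finset.mem_image, Finset.mem_filter] at hx hy
      obtain ⟨a, ⟨ha, hga⟩, rfl⟩ := hx
      obtain ⟨b, ⟨hb, hgb⟩, rfl⟩ := hy
      have h := hg a ha b hb (hga.trans hgb.symm)
      rw [hga] at h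
      exact h)
    exact ⟨s, fun a ha hga => hs (a f) (Finset.mem_image.2 ⟨a, Finset.mem_filter.2 ⟨ha, hga⟩, rfl⟩)⟩
  choose s hs using hwin
  exact ⟨f₀, s, fun a ha => ⟨g a, hgf a ha, hs (g a) a ha rfl⟩⟩

/-! ## (B) bumps by value table and their character expansions -/

/-- adjacent-pair bump: vanishes exactly on `{s, s+1}`, value `2` elsewhere. -/
noncomputable def bumpPair (s t : ZMod 4) : ℝ := if t = s ∨ t = s + 1 then 0 else 2

/-- free bump with phase `w`: values `3/2, 1, 1/2, 1` at `w, w+1, w+2, w+3` (strictly positive). -/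
noncomputable def bumpFree (w t : ZMod 4) : ℝ :=
  if t = w then 3 / 2 else if t = w + 2 then 1 / 2 else 1

/-- `z_s = (−1 − i)·i^s`. -/
noncomputable def zPair (s : ZMod 4) : ℂ := (-1 - Complex.I) * Complex.I ^ s.val

/-- frequency table of `bumpPair s`: `1` at `0`, `conj z_s / 2` at `1`, `z_s / 2` at `3`, `0` at `2`. -/
noncomputable def coefPair (s j : ZMod 4) : ℂ :=
  if j = 0 then 1 else if j = 1 then (starRingEnd ℂ) (zPair s) / 2 else if j = 3 then zPair s / 2 else 0

/-- frequency table of `bumpFree w`: `1` at `0`, `i^{−w}/4` at `1`, `i^{w}/4` at `3`, `0` at `2`. -/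
noncomputable def coefFree (w j : ZMod 4) : ℂ :=
  if j = 0 then 1 else if j = 1 then Complex.I ^ (-w).val / 4
  else if j = 3 then Complex.I ^ w.val / 4 else 0


/-! #### PART B helpers (s4-prove-1 g32): the Re-form `1 + 2 Re(a·e t)` of a three-term character sum, the
hosting coefficient `κ = (−1+i)/2 = conj(z_0)/2`, values by `zmod4_cases` on `t − s` -/

/-- The real phase bump `1 + 2 Re(a·e(t))` (Re-form of `1 + a·e(t) + ā·ē(t)`). -/
noncomputable def bump (a : ℂ) (t : ZMod 4) : ℝ := 1 + 2 * (a * e t).re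

/-- `1 + a·e t + ā·e(3t) = 1 + 2 Re(a·e t)` (as a complex number). -/
theorem three_term_eq_bump (a : ℂ) (t : ZMod 4) :
    (1 : ℂ) + a * e t + (starRingEnd ℂ) a * e (3 * t) = (bump a t : ℂ) := by
  unfold bump
  rw [e_three_mul, add_assoc, ← map_mul, Complex.add_conj]
  push_cast
  ring

/-- The hosting coefficient `κ = (-1 + i)/2`. -/
noncomputable def κ : ℂ := (-1 + Complex.I) / 2

theorem κ_ne_zero : κ ≠ 0 := by
  intro h
  have := congrArg Complex.re h
  norm_num [κ] at this

theorem re_κ_one : (κ * 1).re = -(1 / 2 : ℝ) := by norm_num [κ]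

theorem re_κ_I : (κ * Complex.I).re = -(1 / 2 : ℝ) := by norm_num [κ]

theorem re_κ_neg_one : (κ * -1).re = (1 / 2 : ℝ) := by norm_num [κ]

theorem re_κ_neg_I : (κ * -Complex.I).re = (1 / 2 : ℝ) := by norm_num [κ]

/-- `conj(z_s)/2 = κ · conj(e s)`. -/
theorem conj_zPair_div_two (s : ZMod 4) : (starRingEnd ℂ) (zPair s) / 2 = κ * (starRingEnd ℂ) (e s) := by
  unfold zPair κ
  rw [map_mul, map_sub, map_neg, map_one, Complex.conj_I]
  change (-1 - -Complex.I) * (starRingEnd ℂ) (e s) / 2 = _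
  ring

theorem host_arg (s t : ZMod 4) : κ * (starRingEnd ℂ) (e s) * e t = κ * e (t - s) := by
  rw [sub_eq_add_neg, e_add, e_neg]; ring

theorem two_add_facts (s : ZMod 4) : ¬((2 : ZMod 4) + s = s ∨ (2 : ZMod 4) + s = s + 1) := by
  revert s; decide

theorem three_add_facts (s : ZMod 4) : ¬((3 : ZMod 4) + s = s ∨ (3 : ZMod 4) + s = s + 1) := by
  revert s; decide

theorem one_add_ne (s : ZMod 4) : (1 : ZMod 4) + s ≠ s := by revert s; decide

theorem one_add_ne_add_two (s : ZMod 4) : (1 : ZMod 4) + s ≠ s + 2 := by revert s; decide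

theorem three_add_ne (s : ZMod 4) : (3 : ZMod 4) + s ≠ s := by revert s; decide

theorem three_add_ne_add_two (s : ZMod 4) : (3 : ZMod 4) + s ≠ s + 2 := by revert s; decide

theorem two_add_ne (s : ZMod 4) : (2 : ZMod 4) + s ≠ s := by revert s; decide

/-- The hosting bump in Re-form IS the value table `bumpPair`. -/
theorem bump_host_eq_bumpPair (s t : ZMod 4) : bump (κ * (starRingEnd ℂ) (e s)) t = bumpPair s t := by
  unfold bump bumpPair
  rw [host_arg]
  obtain ⟨d, rfl⟩ : ∃ d, t = d + s := ⟨t - s, (sub_add_cancel t s).symm⟩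
  rw [add_sub_cancel_right]
  rcases zmod4_cases d with rfl | rfl | rfl | rfl
  · rw [zero_add, e_zero, re_κ_one, if_pos (Or.inl rfl)]; norm_num
  · rw [e_one, re_κ_I, if_pos (Or.inr (add_comm _ _))]; norm_num
  · rw [e_two, re_κ_neg_one, if_neg (two_add_facts s)]; norm_num
  · rw [e_three, re_κ_neg_I, if_neg (three_add_facts s)]; norm_num

/-- The free bump in Re-form IS the value table `bumpFree`. -/
theorem bump_free_eq_bumpFree (w t : ZMod 4) : bump (e (-w) / 4) t = bumpFree w t := by
  unfold bump bumpFree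
  have harg : e (-w) / 4 * e t = e (t - w) / 4 := by rw [sub_eq_add_neg, e_add]; ring
  rw [harg]
  obtain ⟨d, rfl⟩ : ∃ d, t = d + w := ⟨t - w, (sub_add_cancel t w).symm⟩
  rw [add_sub_cancel_right]
  rcases zmod4_cases d with rfl | rfl | rfl | rfl
  · rw [zero_add, e_zero, if_pos rfl]; norm_num
  · rw [e_one, if_neg (one_add_ne w), if_neg (one_add_ne_add_two w)]; norm_num
  · rw [e_two, if_neg (two_add_ne w), if_pos (add_comm _ _)]; norm_num
  · rw [e_three, if_neg (three_add_ne w), if_neg (three_add_ne_add_two w)]; norm_num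

theorem coefPair_zero (s : ZMod 4) : coefPair s 0 = 1 := by simp [coefPair]

theorem coefPair_one (s : ZMod 4) : coefPair s 1 = (starRingEnd ℂ) (zPair s) / 2 := by
  simp [coefPair, show (1 : ZMod 4) ≠ 0 from by decide]

theorem coefPair_three (s : ZMod 4) : coefPair s 3 = zPair s / 2 := by
  simp [coefPair, show (3 : ZMod 4) ≠ 0 from by decide, show (3 : ZMod 4) ≠ 1 from by decide]

theorem coefFree_zero (w : ZMod 4) : coefFree w 0 = 1 := by simp [coefFree]

theorem coefFree_one (w : ZMod 4) : coefFree w 1 = e (-w) / 4 := by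
  simp [coefFree, e, show (1 : ZMod 4) ≠ 0 from by decide]

theorem coefFree_three (w : ZMod 4) : coefFree w 3 = e w / 4 := by
  simp [coefFree, e, show (3 : ZMod 4) ≠ 0 from by decide, show (3 : ZMod 4) ≠ 1 from by decide]

/-- `coefPair s 3 = conj (coefPair s 1)` and `coefFree w 3 = conj (coefFree w 1)` (real bumps). -/
theorem coefPair_three_eq_conj (s : ZMod 4) : coefPair s 3 = (starRingEnd ℂ) (coefPair s 1) := by
  rw [coefPair_three, coefPair_one, map_div₀, Complex.conj_conj]
  congr 1
  exact (Complex.conj_ofNat 2).symm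

theorem coefFree_three_eq_conj (w : ZMod 4) : coefFree w 3 = (starRingEnd ℂ) (coefFree w 1) := by
  rw [coefFree_three, coefFree_one, map_div₀, ← e_neg, neg_neg]
  congr 1
  exact (Complex.conj_ofNat 4).symm


theorem bumpPair_nonneg (s t : ZMod 4) : 0 ≤ bumpPair s t := by
  unfold bumpPair; split_ifs <;> norm_num

theorem bumpPair_eq_zero {s t : ZMod 4} (h : t = s ∨ t = s + 1) : bumpPair s t = 0 := by
  unfold bumpPair; rw [if_pos h]

theorem bumpFree_pos (w t : ZMod 4) : 0 < bumpFree w t := by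
  unfold bumpFree; split_ifs <;> norm_num

theorem coefPair_two (s : ZMod 4) : coefPair s 2 = 0 := by
  simp [coefPair, show (2 : ZMod 4) ≠ 0 from by decide, show (2 : ZMod 4) ≠ 1 from by decide,
    show (2 : ZMod 4) ≠ 3 from by decide]

theorem coefFree_two (w : ZMod 4) : coefFree w 2 = 0 := by
  simp [coefFree, show (2 : ZMod 4) ≠ 0 from by decide, show (2 : ZMod 4) ≠ 1 from by decide,
    show (2 : ZMod 4) ≠ 3 from by decide]

theorem bumpPair_expand (s t : ZMod 4) :
    (bumpPair s t : ℂ) = ∑ j : ZMod 4, coefPair s j * Complex.I ^ ((j * t).val) := by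
  change _ = ∑ j : ZMod 4, coefPair s j * e (j * t)
  rw [sum_univ_zmod4, coefPair_zero, coefPair_one, coefPair_two, coefPair_three_eq_conj, coefPair_one, zero_mul,
    e_zero, one_mul, one_mul, zero_mul, add_zero, three_term_eq_bump, conj_zPair_div_two, bump_host_eq_bumpPair]

theorem bumpFree_expand (w t : ZMod 4) :
    (bumpFree w t : ℂ) = ∑ j : ZMod 4, coefFree w j * Complex.I ^ ((j * t).val) := by
  change _ = ∑ j : ZMod 4, coefFree w j * e (j * t)
  rw [sum_univ_zmod4, coefFree_zero, coefFree_two, coefFree_three_eq_conj, coefFree_one, zero_mul, e_zero,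
    one_mul, one_mul, zero_mul, add_zero, three_term_eq_bump, bump_free_eq_bumpFree]

theorem zPair_ne_zero (s : ZMod 4) : zPair s ≠ 0 := by
  unfold zPair
  refine mul_ne_zero (fun h => ?_) (e_ne_zero s)
  have := congrArg Complex.re h
  norm_num at this

/-! ## (D) assembly -/

/-! #### PART D helpers (s4-prove-1 g32): the coefficient∕value vectors of `F_w`, the reduced pairing, one rotation -/

/-- Coefficient tables of `F_w`: the free bump on `f₀`, hosting bumps at `s f` elsewhere. -/
noncomputable def cvec (f₀ : Fin 4) (w : ZMod 4) (s : Fin 4 → ZMod 4) (f : Fin 4) : ZMod 4 → ℂ :=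
  if f = f₀ then coefFree w else coefPair (s f)

/-- Value of the factor `φ_f` of `F_w` at `t`. -/
noncomputable def vvec (f₀ : Fin 4) (w : ZMod 4) (s : Fin 4 → ZMod 4) (f : Fin 4) (t : ZMod 4) : ℝ :=
  if f = f₀ then bumpFree w t else bumpPair (s f) t

theorem cvec_two (f₀ : Fin 4) (w : ZMod 4) (s : Fin 4 → ZMod 4) (f : Fin 4) : cvec f₀ w s f 2 = 0 := by
  unfold cvec; split_ifs
  · exact coefFree_two w
  · exact coefPair_two _

theorem cvec_three (f₀ : Fin 4) (w : ZMod 4) (s : Fin 4 → ZMod 4) (f : Fin 4) :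
    cvec f₀ w s f 3 = (starRingEnd ℂ) (cvec f₀ w s f 1) := by
  unfold cvec; split_ifs
  · exact coefFree_three_eq_conj w
  · exact coefPair_three_eq_conj _

theorem vvec_nonneg (f₀ : Fin 4) (w : ZMod 4) (s : Fin 4 → ZMod 4) (f : Fin 4) (t : ZMod 4) :
    0 ≤ vvec f₀ w s f t := by
  unfold vvec; split_ifs
  · exact (bumpFree_pos w t).le
  · exact bumpPair_nonneg _ t

/-- each factor's trigonometric polynomial is the real value `vvec`. -/
theorem trig_cvec (f₀ : Fin 4) (w : ZMod 4) (s : Fin 4 → ZMod 4) (f : Fin 4) (t : ZMod 4) :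
    ∑ j : ZMod 4, cvec f₀ w s f j * Complex.I ^ ((j * t).val) = (vvec f₀ w s f t : ℂ) := by
  unfold cvec vvec; split_ifs
  · exact (bumpFree_expand w t).symm
  · exact (bumpPair_expand _ t).symm

/-- the frequency-`(1,1,1,1)` coefficient of `F_w`: `e(−w)/4 · P`, `P = ∏_{f ≠ f₀} conj(z_{s f})/2`. -/
theorem prod_cvec_one (f₀ : Fin 4) (w : ZMod 4) (s : Fin 4 → ZMod 4) :
    ∏ f, cvec f₀ w s f 1 = e (-w) / 4 * ∏ f ∈ Finset.univ.erase f₀, (starRingEnd ℂ) (zPair (s f)) / 2 := by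
  rw [← Finset.mul_prod_erase _ _ (Finset.mem_univ f₀)]
  congr 1
  · simp [cvec, coefFree_one]
  · exact Finset.prod_congr rfl fun f hf => by simp [cvec, Finset.ne_of_mem_erase hf, coefPair_one]

/-- Four rotated half-planes meet in `0`. -/
theorem eq_zero_of_re_rot_nonpos (z : ℂ) (h0 : (1 * z).re ≤ 0) (h1 : (Complex.I * z).re ≤ 0)
    (h2 : (-1 * z).re ≤ 0) (h3 : (-Complex.I * z).re ≤ 0) : z = 0 := by
  apply Complex.ext <;> simp at h0 h1 h2 h3 ⊢ <;> linarith

/-- **One rotation `w`**: `Re( (∏_f c_f(1)) · μ ) ≤ 0`. -/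
theorem rot_step (ω : PT → ℝ) (A : Finset PT) (hω : ∀ τ, τ ∉ A → ω τ ≤ 0)
    (hK : ∀ k, KAdm k → moment ω k = 0) (f₀ : Fin 4) (s : Fin 4 → ZMod 4)
    (hbox : ∀ a ∈ A, ∃ f, f ≠ f₀ ∧ (a f = s f ∨ a f = s f + 1)) (w : ZMod 4) :
    ((∏ f, cvec f₀ w s f 1) * moment ω (fun _ => 1)).re ≤ 0 := by
  -- the pairing of ω with F_w, expanded and reduced to the two top moments
  have hS := pairing_expansion ω (cvec f₀ w s)
  have hred : ∑ k : PT, (∏ f, cvec f₀ w s f (k f)) * moment ω k =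
      (∏ f, cvec f₀ w s f 1) * moment ω (fun _ => 1) + (∏ f, cvec f₀ w s f 3) * moment ω (fun _ => 3) := by
    have hne : (fun _ => (1 : ZMod 4) : PT) ≠ (fun _ => 3) := fun h => absurd (congr_fun h 0) (by decide)
    rw [Finset.sum_eq_add (fun _ => (1 : ZMod 4)) (fun _ => (3 : ZMod 4)) hne]
    · intro k _ hk
      by_cases h : ∃ f, k f = 2
      · obtain ⟨f, hf⟩ := h
        rw [Finset.prod_eq_zero (Finset.mem_univ f) (by rw [hf, cvec_two]), zero_mul]
      · rw [hK k ⟨fun f hf => h ⟨f, hf⟩, hk.1, hk.2⟩, mul_zero]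
    · intro h; exact absurd (Finset.mem_univ _) h
    · intro h; exact absurd (Finset.mem_univ _) h
  have hc3 : ∏ f, cvec f₀ w s f 3 = (starRingEnd ℂ) (∏ f, cvec f₀ w s f 1) := by
    rw [map_prod]; exact Finset.prod_congr rfl fun f _ => cvec_three f₀ w s f
  rw [hred, hc3, moment_three_eq_conj_moment_one, ← map_mul, Complex.add_conj] at hS
  -- the pairing is a real number ≤ 0
  have hreal : ∑ τ : PT, (ω τ : ℂ) * ∏ f, (∑ j : ZMod 4, cvec f₀ w s f j * Complex.I ^ ((j * τ f).val)) =
      ((∑ τ : PT, ω τ * ∏ f, vvec f₀ w s f (τ f) : ℝ) : ℂ) := by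
    push_cast
    refine Finset.sum_congr rfl fun τ _ => ?_
    congr 1
    exact Finset.prod_congr rfl fun f _ => trig_cvec f₀ w s f (τ f)
  have hnonpos : ∑ τ : PT, ω τ * ∏ f, vvec f₀ w s f (τ f) ≤ 0 := by
    apply Finset.sum_nonpos
    intro τ _
    by_cases hτ : τ ∈ A
    · obtain ⟨f, hf, hval⟩ := hbox τ hτ
      have h0 : ∏ f, vvec f₀ w s f (τ f) = 0 := by
        apply Finset.prod_eq_zero (Finset.mem_univ f)
        unfold vvec
        rw [if_neg hf]
        exact bumpPair_eq_zero hval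
      rw [h0, mul_zero]
    · exact mul_nonpos_iff.2 (Or.inr ⟨hω τ hτ, Finset.prod_nonneg fun f _ => vvec_nonneg f₀ w s f (τ f)⟩)
  rw [hreal] at hS
  have h2 : (∑ τ : PT, ω τ * ∏ f, vvec f₀ w s f (τ f)) =
      2 * ((∏ f, cvec f₀ w s f 1) * moment ω (fun _ => 1)).re := by exact_mod_cast hS
  linarith


/-- **The phase-torus law holds** (kernel target; pen ×2). -/
theorem phaseTorusLaw_holds : PhaseTorusLaw := by
  intro ω A hA hω hK
  obtain ⟨f₀, s, hbox⟩ := coveringLemmaBox_holds A hA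
  set P : ℂ := ∏ f ∈ Finset.univ.erase f₀, (starRingEnd ℂ) (zPair (s f)) / 2 with hP
  have hPne : P ≠ 0 := Finset.prod_ne_zero_iff.2 fun f _ =>
    div_ne_zero ((map_ne_zero _).2 (zPair_ne_zero _)) (by norm_num)
  -- the four rotations
  have key : ∀ w : ZMod 4, (e (-w) * (P * moment ω (fun _ => 1) / 4)).re ≤ 0 := by
    intro w
    have h := rot_step ω A hω hK f₀ s hbox w
    rw [prod_cvec_one] at h
    have hrw : e (-w) / 4 * P * moment ω (fun _ => 1) = e (-w) * (P * moment ω (fun _ => 1) / 4) := by ring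
    rw [hrw] at h
    exact h
  have hz : P * moment ω (fun _ => 1) / 4 = 0 := by
    apply eq_zero_of_re_rot_nonpos
    · have := key 0; rwa [neg_zero, e_zero] at this
    · have := key 3; rwa [show (-3 : ZMod 4) = 1 from by decide, e_one] at this
    · have := key 2; rwa [show (-2 : ZMod 4) = 2 from by decide, e_two] at this
    · have := key 1; rwa [show (-1 : ZMod 4) = 3 from by decide, e_three] at this
  have h4 : (4 : ℂ) ≠ 0 := by norm_num
  rcases mul_eq_zero.1 ((div_eq_zero_iff.1 hz).resolve_right h4) with h | h
  · exact absurd h hPne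
  · exact h

/-- former stub of `PhaseTorusLaw.lean` v1/v2, name kept. -/
theorem stub_phaseTorusLaw : PhaseTorusLaw := phaseTorusLaw_holds



/-! ## PART E — the sharp covering range (control g5, memo §9): box covering for every `|A| ≤ 7` (any prescribed free
coordinate), hence the phase-torus law at corank `≤ 7`.  Greedy halving: on one coordinate some adjacent pair `{s, s+1}`
hosts at least half of any finite set (each value lies in exactly two of the four adjacent pairs), so three coordinates
host `7 → ≤ 3 → ≤ 1 → 0`.  The first obstruction is `|A| = 8` (2-cube tilings `E8 ∕ O8`, memo §9; not typed here). -/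

/-- on a fixed coordinate `f`, some adjacent pair `{s, s+1}` leaves at most half of `B` unhosted. -/
theorem exists_half_host (B : Finset PT) (f : Fin 4) :
    ∃ s : ZMod 4, 2 * (B.filter (fun a => ¬(a f = s ∨ a f = s + 1))).card ≤ B.card := by
  by_contra hcon
  rw [not_exists] at hcon
  -- double counting: Σ_s #unhosted_s = Σ_a #{s : a f ∉ {s, s+1}} = 2·|B|
  have hcount : ∀ v : ZMod 4, (Finset.univ.filter (fun s : ZMod 4 => ¬(v = s ∨ v = s + 1))).card = 2 := by
    decide
  have hsum : ∑ s : ZMod 4, (B.filter (fun a => ¬(a f = s ∨ a f = s + 1))).card = 2 * B.card := by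
    simp only [Finset.card_filter]
    rw [Finset.sum_comm]
    simp only [← Finset.card_filter, hcount]
    simp [Finset.sum_const, mul_comm]
  have hlt : ∑ s : ZMod 4, B.card < ∑ s : ZMod 4, 2 * (B.filter (fun a => ¬(a f = s ∨ a f = s + 1))).card :=
    Finset.sum_lt_sum_of_nonempty Finset.univ_nonempty fun s _ => not_le.mp (hcon s)
  rw [← Finset.mul_sum, hsum] at hlt
  simp at hlt
  omega

/-- **box covering for `|A| ≤ 7`**, with any prescribed free coordinate `f₀`. -/
theorem box_cover_seven (A : Finset PT) (hA : A.card ≤ 7) (f₀ : Fin 4) :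
    ∃ s : Fin 4 → ZMod 4, ∀ a ∈ A, ∃ f, f ≠ f₀ ∧ (a f = s f ∨ a f = s f + 1) := by
  have h1 : f₀ + 1 ≠ f₀ := by revert f₀; decide
  have h2 : f₀ + 2 ≠ f₀ := by revert f₀; decide
  have h3 : f₀ + 3 ≠ f₀ := by revert f₀; decide
  have h12 : f₀ + 1 ≠ f₀ + 2 := by revert f₀; decide
  have h13 : f₀ + 1 ≠ f₀ + 3 := by revert f₀; decide
  have h23 : f₀ + 2 ≠ f₀ + 3 := by revert f₀; decide
  obtain ⟨s₁, hs₁⟩ := exists_half_host A (f₀ + 1)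
  set B₁ := A.filter (fun a => ¬(a (f₀ + 1) = s₁ ∨ a (f₀ + 1) = s₁ + 1)) with hB₁
  obtain ⟨s₂, hs₂⟩ := exists_half_host B₁ (f₀ + 2)
  set B₂ := B₁.filter (fun a => ¬(a (f₀ + 2) = s₂ ∨ a (f₀ + 2) = s₂ + 1)) with hB₂
  obtain ⟨s₃, hs₃⟩ := exists_half_host B₂ (f₀ + 3)
  set B₃ := B₂.filter (fun a => ¬(a (f₀ + 3) = s₃ ∨ a (f₀ + 3) = s₃ + 1)) with hB₃
  have hB₃e : B₃ = ∅ := by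
    apply Finset.card_eq_zero.mp
    omega
  refine ⟨fun f => if f = f₀ + 1 then s₁ else if f = f₀ + 2 then s₂ else s₃, fun a ha => ?_⟩
  by_cases c1 : a (f₀ + 1) = s₁ ∨ a (f₀ + 1) = s₁ + 1
  · exact ⟨f₀ + 1, h1, by simpa using c1⟩
  have ha1 : a ∈ B₁ := Finset.mem_filter.2 ⟨ha, c1⟩
  by_cases c2 : a (f₀ + 2) = s₂ ∨ a (f₀ + 2) = s₂ + 1
  · exact ⟨f₀ + 2, h2, by simpa [h12.symm] using c2⟩
  have ha2 : a ∈ B₂ := Finset.mem_filter.2 ⟨ha1, c2⟩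
  by_cases c3 : a (f₀ + 3) = s₃ ∨ a (f₀ + 3) = s₃ + 1
  · exact ⟨f₀ + 3, h3, by simpa [h13.symm, h23.symm] using c3⟩
  have ha3 : a ∈ B₃ := Finset.mem_filter.2 ⟨ha2, c3⟩
  rw [hB₃e] at ha3
  simp at ha3

/-- the phase-torus law at corank `≤ 7` (the sharp covering range; memo §9). -/
def PhaseTorusLaw7 : Prop :=
  ∀ (ω : PT → ℝ) (A : Finset PT), A.card ≤ 7 → (∀ τ, τ ∉ A → ω τ ≤ 0) →
    (∀ k, KAdm k → moment ω k = 0) → moment ω (fun _ => 1) = 0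

/-- **the phase-torus law holds at corank `≤ 7`** (same certificate as `phaseTorusLaw_holds`, box from `box_cover_seven`). -/
theorem phaseTorusLaw7_holds : PhaseTorusLaw7 := by
  intro ω A hA hω hK
  obtain ⟨s, hbox⟩ := box_cover_seven A hA 0
  set P : ℂ := ∏ f ∈ Finset.univ.erase (0 : Fin 4), (starRingEnd ℂ) (zPair (s f)) / 2 with hP
  have hPne : P ≠ 0 := Finset.prod_ne_zero_iff.2 fun f _ =>
    div_ne_zero ((map_ne_zero _).2 (zPair_ne_zero _)) (by norm_num)
  have key : ∀ w : ZMod 4, (e (-w) * (P * moment ω (fun _ => 1) / 4)).re ≤ 0 := by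
    intro w
    have h := rot_step ω A hω hK 0 s hbox w
    rw [prod_cvec_one] at h
    have hrw : e (-w) / 4 * P * moment ω (fun _ => 1) = e (-w) * (P * moment ω (fun _ => 1) / 4) := by ring
    rw [hrw] at h
    exact h
  have hz : P * moment ω (fun _ => 1) / 4 = 0 := by
    apply eq_zero_of_re_rot_nonpos
    · have := key 0; rwa [neg_zero, e_zero] at this
    · have := key 3; rwa [show (-3 : ZMod 4) = 1 from by decide, e_one] at this
    · have := key 2; rwa [show (-2 : ZMod 4) = 2 from by decide, e_two] at this
    · have := key 1; rwa [show (-1 : ZMod 4) = 3 from by decide, e_three] at this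
  have h4 : (4 : ℂ) ≠ 0 := by norm_num
  rcases mul_eq_zero.1 ((div_eq_zero_iff.1 hz).resolve_right h4) with h | h
  · exact absurd h hPne
  · exact h

/-- the corank-`≤ 4` law is a special case. -/
theorem phaseTorusLaw_of_seven (h7 : PhaseTorusLaw7) : PhaseTorusLaw :=
  fun ω A hA hω hK => h7 ω A (hA.trans (by norm_num)) hω hK


end Summit.HodgeConjecture.HodgeConjecture.Cruxes.BlochSeedDiscOne.PhaseTorus
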